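import Literature.NumberTheory.Sieve.GoldstonPintzYildirimLemma3Setup
import HarnessLib

/-!
# Goldston–Pintz–Yıldırım, Lemma 3 — the inner decomposition in the variable `w = s₁ + s₂`

Trunk: NumberTheory / Sieve, continuing `GoldstonPintzYildirimLemma3Setup` (GPY, *Primes in
tuples I*, §8). For FIXED `s₂` (on the line `Re s₂ = θ₂ > 0`, which the outer integral of (8.1)
runs over after `integral_integral_lemma3F_lines_eq`), the inner integral over `Re s₁ = θ` is
rewritten in the variable `w = s₁ + s₂` (a translation of the line of integration), where the
integrand `g(w) = F(w − s₂, s₂) = D(w−s₂,s₂) R^w / ((w−s₂)^{u+1} s₂^{v+1} w^d)` has exactly two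
poles, `w = s₂` (i.e. `s₁ = 0`) and `w = 0` (i.e. `s₁ + s₂ = 0`, the "diagonal" pole producing
GPY's term `I₃` of (8.8)), and the `R`-dependence is `R^w` alone. Moving the line `Re w = θ + θ₂`
to the left edge `Re w = −σ_w` inside the zero-free region ((5.3) for `W(w − s₂)`), across the
two poles, is Cauchy's theorem for a rectangle with two holes
(`Literature.Analysis.Complex.rectBoundaryIntegral_eq_add_of_differentiableOn_two_holes_re`).
Everything here is PROVED:

* `Literature.NumberTheory.Sieve.GPY.lemma3g` — `g_{s₂}(w) = F(w − s₂, s₂)`;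
  `integral_lemma3F_eq_integral_lemma3g` — the translation
  `∫ F(θ+it₁, s₂) dt₁ = ∫ g((θ + Re s₂) + iτ) dτ`;
* `Literature.NumberTheory.Sieve.GPY.diagRes` — `r(s₂) = ∮_{∂Q(0,η)} g_{s₂}` (`2πi ·` the residue
  at `s₁ + s₂ = 0`); `Literature.NumberTheory.Sieve.GPY.zeroRes` — `ρ₀(s₂) = ∮_{∂Q(0,η)} F(·, s₂)`
  (`2πi ·` the residue at `s₁ = 0`), and `rectBoundaryIntegral_lemma3g_eq_zeroRes`
  (`∮_{∂Q(s₂,η)} g_{s₂} = ρ₀(s₂)`, translation);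
* `differentiableOn_lemma3g` — `g_{s₂}` is holomorphic on the closed rectangle
  `[−σ_w, θ + Re s₂] × [−T_w, T_w]` minus the two open squares, provided
  `σ_w + Re s₂ ≤ 4c̄/log(T_w + |Im s₂| + 3)` (zero-free region for `W(w − s₂)`) and the squares
  fit;
* `integral_lemma3g_segment_eq` — **the inner decomposition**:
  `∫_{−T_w}^{T_w} g(c+iτ) dτ = ∫_{−T_w}^{T_w} g(−σ_w+iτ) dτ − i (r(s₂) + ρ₀(s₂) − ∫_bot + ∫_top)`,
  `c = θ + Re s₂`, with the bottom/top edges `∫_{−σ_w}^{c} g(x ∓ iT_w) dx`.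

* the bounds for the pieces (fixed `s₂` with `0 < Re s₂ ≤ 1`, `|Im s₂| ≤ T`, `|G| ≤ B` on
  `−κ ≤ Re sᵢ ≤ 2`, zero-free data `c̄, C`): `norm_lemma3F_le_master` (pointwise, from bounds
  `Z, A₁, A₂` for `|W(s₁+s₂)|/|s₁+s₂|`, `|W(s₁)⁻¹||s₁|`, `|W(s₂)⁻¹||s₂|`),
  `norm_integral_lemma3g_left_le` (left edge: `≪ B R^{−σ_w}`), `norm_integral_lemma3g_horizontal_le`
  (top/bottom: `≪ B R^{θ+θ₂}/(T_w − T)^{u+1+a}`), `norm_integral_lemma3g_tail_le` (tails: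
  `≪ B/T_w`, via `norm_integral_sub_intervalIntegral_le`), `norm_diagRes_le`
  (`|r(s₂)| ≤ 8η B (3/2η)^d (Cℓ₂)^{a+b} R^η 2^{u+1+a}/|s₂|^{u+v+a+b+2}`, `ℓ₂ = log(|Im s₂|+η+3)`,
  the pointwise `log` being kept for the `t₂`-integration of GPY's `I₃`).

The outer (`s₂`-plane) stage is in the sequel.

## References

* D. A. Goldston, J. Pintz, C. Y. Yıldırım, *Primes in tuples. I*, Ann. of Math. (2) 170 (2009),
  819–862 = arXiv:math/0508185, §8, (8.7)–(8.8) and (8.20)–(8.23). [cite: GoldstonPintzYildirim2009]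
-/

noncomputable section

open Complex Filter Topology MeasureTheory Set intervalIntegral
open scoped Real Interval

namespace Literature.NumberTheory.Sieve.GPY

open Literature.Analysis.Complex (rectBoundaryIntegral)
open Literature.NumberTheory.LFunctions.Nicolas (zetaOne zetaOne_zero differentiable_zetaOne zetaOne_of_ne_zero)

/-! ### The zero-free region at bounded height -/

/-- Monotonicity of the region (5.3): if `z ≠ 0`, `|Im z| ≤ Y` and `Re z ≥ −4c̄/log(Y+3)`
(`c̄ ≥ 0`) then `Re z ≥ −4c̄/log(|Im z|+3)`. [cite: GoldstonPintzYildirim2009, Section 5 eq. 5.3] -/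
theorem region_of_height_le {cbar Y : ℝ} (hc : 0 ≤ cbar) {z : ℂ} (hY : |z.im| ≤ Y)
    (hσ : -(4 * cbar / Real.log (Y + 3)) ≤ z.re) : -(4 * cbar / Real.log (|z.im| + 3)) ≤ z.re := by
  have hL1 : 1 < Real.log (|z.im| + 3) :=
    Literature.NumberTheory.LFunctions.ZetaClassicalRegion.one_lt_log_abs_add_three z.im
  have hle : Real.log (|z.im| + 3) ≤ Real.log (Y + 3) :=
    Real.log_le_log (by linarith [abs_nonneg z.im]) (by linarith)
  have h1 : 4 * cbar / Real.log (Y + 3) ≤ 4 * cbar / Real.log (|z.im| + 3) :=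
    div_le_div_of_nonneg_left (by linarith) (by linarith) hle
  linarith

section Inner

variable {G : ℂ → ℂ → ℂ} {cbar C : ℝ}

/-! ### `g_{s₂}(w) = F(w − s₂, s₂)` and the translation -/

/-- The integrand of (8.1) in the variables `(w, s₂)`, `w = s₁ + s₂`:
`g_{s₂}(w) = F(w − s₂, s₂) = D(w−s₂, s₂) R^w / ((w−s₂)^{u+1} s₂^{v+1} w^d)`.
[cite: GoldstonPintzYildirim2009, Section 8 eq. 8.1] -/
def lemma3g (G : ℂ → ℂ → ℂ) (R : ℝ) (a b d u v : ℕ) (s₂ w : ℂ) : ℂ :=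
  lemma3F G R a b d u v (w - s₂) s₂

/-- **Translation**: `∫ F(θ + it₁, s₂) dt₁ = ∫ g_{s₂}((θ + Re s₂) + iτ) dτ` (the substitution
`τ = t₁ + Im s₂`; no integrability needed). [folklore] -/
theorem integral_lemma3F_eq_integral_lemma3g (R : ℝ) (a b d u v : ℕ) (θ : ℝ) (s₂ : ℂ) :
    ∫ t₁ : ℝ, lemma3F G R a b d u v ((θ : ℂ) + t₁ * I) s₂ =
      ∫ τ : ℝ, lemma3g G R a b d u v s₂ (((θ + s₂.re : ℝ) : ℂ) + τ * I) := by
  have h : ∀ τ : ℝ, lemma3g G R a b d u v s₂ (((θ + s₂.re : ℝ) : ℂ) + τ * I) =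
      lemma3F G R a b d u v ((θ : ℂ) + ((τ - s₂.im : ℝ) : ℂ) * I) s₂ := by
    intro τ
    unfold lemma3g
    congr 1
    apply Complex.ext <;> simp
  simp_rw [h]
  exact (integral_sub_right_eq_self (fun t : ℝ => lemma3F G R a b d u v ((θ : ℂ) + (t : ℂ) * I) s₂)
    s₂.im).symm

/-! ### The two residue terms -/

/-- `r(s₂) = ∮_{∂Q(0,η)} g_{s₂}(w) dw`: `2πi` times the residue of `g_{s₂}` at `w = 0`, i.e. of
`F(·, s₂)` at the diagonal pole `s₁ = −s₂` (GPY's `Res_{s₂=−s₁}` of (8.8), the source of `I₃`).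
[cite: GoldstonPintzYildirim2009, Section 8 eq. 8.20] -/
def diagRes (G : ℂ → ℂ → ℂ) (R : ℝ) (a b d u v : ℕ) (η : ℝ) (s₂ : ℂ) : ℂ :=
  rectBoundaryIntegral (lemma3g G R a b d u v s₂) (-η) η (-η) η

/-- `ρ₀(s₂) = ∮_{∂Q(0,η)} F(s₁, s₂) ds₁`: `2πi` times the residue of `F(·, s₂)` at `s₁ = 0`
(GPY's `Res_{s₁=0}` of (8.7)–(8.9)). [cite: GoldstonPintzYildirim2009, Section 8 eq. 8.9] -/
def zeroRes (G : ℂ → ℂ → ℂ) (R : ℝ) (a b d u v : ℕ) (η : ℝ) (s₂ : ℂ) : ℂ :=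
  rectBoundaryIntegral (fun s₁ => lemma3F G R a b d u v s₁ s₂) (-η) η (-η) η

/-- `∮_{∂Q(s₂,η)} g_{s₂} = ρ₀(s₂)` (translate by `s₂`). [folklore] -/
theorem rectBoundaryIntegral_lemma3g_eq_zeroRes (R : ℝ) (a b d u v : ℕ) (η : ℝ) (s₂ : ℂ) :
    rectBoundaryIntegral (lemma3g G R a b d u v s₂) (s₂.re - η) (s₂.re + η) (s₂.im - η) (s₂.im + η) =
      zeroRes G R a b d u v η s₂ := by
  have h := Literature.Analysis.Complex.rectBoundaryIntegral_comp_add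
    (fun s₁ => lemma3F G R a b d u v s₁ s₂) (-s₂) (s₂.re - η) (s₂.re + η) (s₂.im - η) (s₂.im + η)
  simp only [neg_re, neg_im] at h
  rw [show s₂.re - η + -s₂.re = -η by ring, show s₂.re + η + -s₂.re = η by ring,
    show s₂.im - η + -s₂.im = -η by ring, show s₂.im + η + -s₂.im = η by ring] at h
  rw [zeroRes, ← h]
  rfl

/-! ### Holomorphy of `g_{s₂}` on the rectangle with two holes -/

/-- **`g_{s₂}` is holomorphic off its two poles**, on the closed rectangle
`[−σ_w, θ + Re s₂] × [−T_w, T_w]` minus the open squares `Q(0,η)°`, `Q(s₂,η)°`, provided: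
`0 < η`, `0 < Re s₂`, `σ_w + Re s₂ < 1/4`, `σ_w + Re s₂ ≤ 4c̄/log(T_w + |Im s₂| + 3)` (the
zero-free region (5.3) for `W(w − s₂)`), `R > 0`, and `G` holomorphic on `Re sᵢ > −1/4`.
[cite: GoldstonPintzYildirim2009, Section 8 eq. 8.7] -/
theorem differentiableOn_lemma3g
    (hWz : ∀ z : ℂ, z ≠ 0 → -(4 * cbar / Real.log (|z.im| + 3)) ≤ z.re → zetaOne z ≠ 0)
    (hc : 0 ≤ cbar) (hG : DifferentiableOn ℂ (fun z : ℂ × ℂ => G z.1 z.2) G₂Region)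
    {R : ℝ} (hR : 0 < R) (a b d u v : ℕ) {θ η σw Tw : ℝ} {s₂ : ℂ} (hη : 0 < η) (hs₂ : 0 < s₂.re)
    (hquarter : σw + s₂.re < 1 / 4)
    (hzfr : σw + s₂.re ≤ 4 * cbar / Real.log (Tw + |s₂.im| + 3)) :
    DifferentiableOn ℂ (lemma3g G R a b d u v s₂)
      ((Icc (-σw) (θ + s₂.re) ×ℂ Icc (-Tw) Tw) \
        ((Ioo (-η) η ×ℂ Ioo (-η) η) ∪ (Ioo (s₂.re - η) (s₂.re + η) ×ℂ Ioo (s₂.im - η) (s₂.im + η)))) := by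
  intro w hw
  obtain ⟨⟨hwre, hwim⟩, hwout⟩ := hw
  have hw0 : w ≠ 0 := by
    intro h
    apply hwout
    left
    rw [h]
    exact ⟨⟨by simpa using hη, by simpa using hη⟩, ⟨by simpa using hη, by simpa using hη⟩⟩
  have hws : w ≠ s₂ := by
    intro h
    apply hwout
    right
    rw [h]
    exact ⟨⟨by linarith, by linarith⟩, ⟨by linarith, by linarith⟩⟩
  have hs2ne : s₂ ≠ 0 := fun h => by rw [h] at hs₂; simp at hs₂
  set s₁ := w - s₂ with hs₁def
  have hs1ne : s₁ ≠ 0 := sub_ne_zero.2 hws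
  have hs1re : -1 / 4 < s₁.re := by
    have : s₁.re = w.re - s₂.re := by rw [hs₁def, sub_re]
    rw [this]; linarith [hwre.1]
  have hW1 : zetaOne s₁ ≠ 0 := by
    refine hWz s₁ hs1ne (region_of_height_le hc (Y := Tw + |s₂.im|) ?_ ?_)
    · have : s₁.im = w.im - s₂.im := by rw [hs₁def, sub_im]
      rw [this]
      have h1 : |w.im| ≤ Tw := abs_le.2 ⟨hwim.1, hwim.2⟩
      calc |w.im - s₂.im| ≤ |w.im| + |s₂.im| := abs_sub _ _
        _ ≤ Tw + |s₂.im| := by linarith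
    · have : s₁.re = w.re - s₂.re := by rw [hs₁def, sub_re]
      rw [this]
      linarith [hwre.1]
  have hW2 : zetaOne s₂ ≠ 0 := zetaOne_ne_zero_of_re_pos hs₂
  have h12 : s₁ + s₂ ≠ 0 := by rw [hs₁def, sub_add_cancel]; exact hw0
  have hF := differentiableAt_lemma3F_fst hG hR a b d u v hs1re (by linarith) hW1 hW2 hs1ne hs2ne h12
  have hcomp : DifferentiableAt ℂ (fun w : ℂ => lemma3F G R a b d u v (w - s₂) s₂) w :=
    hF.comp w (differentiableAt_id.sub_const s₂)
  exact hcomp.differentiableWithinAt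

/-! ### The inner decomposition -/

/-- **The inner decomposition in the `w`-plane** (the `s₁`-shift of GPY §8 in the variable
`w = s₁ + s₂`, crossing the poles `w = s₂` (`s₁ = 0`) and `w = 0` (`s₁ + s₂ = 0`)): with
`c = θ + Re s₂`,
`∫_{−T_w}^{T_w} g(c+iτ) dτ = ∫_{−T_w}^{T_w} g(−σ_w+iτ) dτ − i·(r(s₂) + ρ₀(s₂) − ∫_{−σ_w}^{c} g(x − iT_w)dx + ∫_{−σ_w}^{c} g(x + iT_w)dx)`,
under the hypotheses of `differentiableOn_lemma3g` and the geometric conditions `η ≤ θ`,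
`2η ≤ Re s₂`, `η < σ_w`, `|Im s₂| + η ≤ T_w`, `η ≤ T_w`.
[cite: GoldstonPintzYildirim2009, Section 8 eq. 8.8] -/
theorem integral_lemma3g_segment_eq
    (hWz : ∀ z : ℂ, z ≠ 0 → -(4 * cbar / Real.log (|z.im| + 3)) ≤ z.re → zetaOne z ≠ 0)
    (hc : 0 ≤ cbar) (hG : DifferentiableOn ℂ (fun z : ℂ × ℂ => G z.1 z.2) G₂Region)
    {R : ℝ} (hR : 0 < R) (a b d u v : ℕ) {θ η σw Tw : ℝ} {s₂ : ℂ} (hη : 0 < η) (hηθ : η ≤ θ)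
    (hηs : 2 * η ≤ s₂.re) (hησ : η < σw) (hT : |s₂.im| + η ≤ Tw)
    (hquarter : σw + s₂.re < 1 / 4)
    (hzfr : σw + s₂.re ≤ 4 * cbar / Real.log (Tw + |s₂.im| + 3)) :
    ∫ τ : ℝ in (-Tw)..Tw, lemma3g G R a b d u v s₂ (((θ + s₂.re : ℝ) : ℂ) + τ * I) =
      (∫ τ : ℝ in (-Tw)..Tw, lemma3g G R a b d u v s₂ (((-σw : ℝ) : ℂ) + τ * I)) -
        I * (diagRes G R a b d u v η s₂ + zeroRes G R a b d u v η s₂ -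
          (∫ x : ℝ in (-σw)..(θ + s₂.re), lemma3g G R a b d u v s₂ ((x : ℂ) + ((-Tw : ℝ) : ℂ) * I)) +
          ∫ x : ℝ in (-σw)..(θ + s₂.re), lemma3g G R a b d u v s₂ ((x : ℂ) + (Tw : ℂ) * I)) := by
  have hs₂ : 0 < s₂.re := by linarith
  have hTη : η ≤ Tw := by linarith [abs_nonneg s₂.im]
  have hdiff := differentiableOn_lemma3g hWz hc hG hR a b d u v (θ := θ) (η := η) (σw := σw)
    (Tw := Tw) hη hs₂ hquarter hzfr
  -- the two-holes theorem, separated by the vertical line `Re w = η`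
  have htwo := Literature.Analysis.Complex.rectBoundaryIntegral_eq_add_of_differentiableOn_two_holes_re
    (F := lemma3g G R a b d u v s₂) (a := -σw) (b := θ + s₂.re) (c := -Tw) (d := Tw)
    (a₁ := -η) (b₁ := η) (c₁ := -η) (d₁ := η)
    (a₂ := s₂.re - η) (b₂ := s₂.re + η) (c₂ := s₂.im - η) (d₂ := s₂.im + η) (m := η)
    (by linarith) (by linarith) le_rfl (by linarith) (by linarith) (by linarith)
    (by linarith) (by linarith) hTη
    (by linarith [(abs_le.1 (le_trans (le_add_of_nonneg_right hη.le) hT)).1, neg_abs_le s₂.im])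
    (by linarith) (by linarith [le_abs_self s₂.im]) hdiff
  rw [rectBoundaryIntegral_lemma3g_eq_zeroRes] at htwo
  -- unfold the big rectangle boundary integral
  rw [Literature.Analysis.Complex.rectBoundaryIntegral] at htwo
  rw [diagRes]
  -- `htwo : bot − top + I∫_right − I∫_left = r + ρ₀`; solve for the right edge using `I² = −1`
  linear_combination (-I) * htwo +
    ((∫ y : ℝ in (-Tw)..Tw, lemma3g G R a b d u v s₂ (↑(θ + s₂.re) + ↑y * I)) -
      ∫ y : ℝ in (-Tw)..Tw, lemma3g G R a b d u v s₂ (↑(-σw) + ↑y * I)) * Complex.I_sq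

/-! ### A master pointwise bound -/

/-- **Master pointwise bound.** If `|G(s₁,s₂)| ≤ B_G`, `|W(s₁+s₂)|/|s₁+s₂| ≤ Z`,
`|W(s₁)⁻¹| ≤ A₁/|s₁|`, `|W(s₂)⁻¹| ≤ A₂/|s₂|` (all quantities nonnegative, `s₁, s₂, s₁+s₂ ≠ 0`,
`W(sᵢ) ≠ 0`, `R > 0`), then
`|F(s₁,s₂)| ≤ B_G Z^d A₁^a A₂^b R^{σ₁+σ₂} / (|s₁|^{u+1+a} |s₂|^{v+1+b})`.
[cite: GoldstonPintzYildirim2009, Section 8 eq. 8.16] -/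
theorem norm_lemma3F_le_master {R : ℝ} (hR : 0 < R) (a b d u v : ℕ) {s₁ s₂ : ℂ}
    (h1 : s₁ ≠ 0) (h2 : s₂ ≠ 0) (h12 : s₁ + s₂ ≠ 0) (hW1 : zetaOne s₁ ≠ 0) (hW2 : zetaOne s₂ ≠ 0)
    {BG Z A₁ A₂ : ℝ} (hBG0 : 0 ≤ BG) (hZ0 : 0 ≤ Z) (hA₁0 : 0 ≤ A₁)
    (hBG : ‖G s₁ s₂‖ ≤ BG) (hZ : ‖zetaOne (s₁ + s₂)‖ / ‖s₁ + s₂‖ ≤ Z)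
    (hA₁ : ‖(zetaOne s₁)⁻¹‖ ≤ A₁ / ‖s₁‖) (hA₂ : ‖(zetaOne s₂)⁻¹‖ ≤ A₂ / ‖s₂‖) :
    ‖lemma3F G R a b d u v s₁ s₂‖ ≤
      BG * Z ^ d * A₁ ^ a * A₂ ^ b * R ^ (s₁.re + s₂.re) *
        ((‖s₁‖ ^ (u + 1 + a))⁻¹ * (‖s₂‖ ^ (v + 1 + b))⁻¹) := by
  have hn1 : 0 < ‖s₁‖ := norm_pos_iff.2 h1
  have hn2 : 0 < ‖s₂‖ := norm_pos_iff.2 h2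
  refine (norm_lemma3F_le G hR a b d u v h1 h2 h12 hW1 hW2).trans ?_
  have hp12 : (‖zetaOne (s₁ + s₂)‖ / ‖s₁ + s₂‖) ^ d ≤ Z ^ d := pow_le_pow_left₀ (by positivity) hZ d
  have hp1 : ‖(zetaOne s₁)⁻¹‖ ^ a ≤ (A₁ / ‖s₁‖) ^ a := pow_le_pow_left₀ (by positivity) hA₁ a
  have hp2 : ‖(zetaOne s₂)⁻¹‖ ^ b ≤ (A₂ / ‖s₂‖) ^ b := pow_le_pow_left₀ (by positivity) hA₂ b
  have hN : ‖G s₁ s₂‖ * (‖zetaOne (s₁ + s₂)‖ / ‖s₁ + s₂‖) ^ d * ‖(zetaOne s₁)⁻¹‖ ^ a * ‖(zetaOne s₂)⁻¹‖ ^ b ≤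
      BG * Z ^ d * (A₁ / ‖s₁‖) ^ a * (A₂ / ‖s₂‖) ^ b :=
    mul_le_mul (mul_le_mul (mul_le_mul hBG hp12 (by positivity) hBG0) hp1 (by positivity)
      (by positivity)) hp2 (by positivity) (by positivity)
  have hrest : 0 ≤ R ^ (s₁.re + s₂.re) / (‖s₁‖ ^ (u + 1) * ‖s₂‖ ^ (v + 1)) := by positivity
  calc ‖G s₁ s₂‖ * (‖zetaOne (s₁ + s₂)‖ / ‖s₁ + s₂‖) ^ d * ‖(zetaOne s₁)⁻¹‖ ^ a * ‖(zetaOne s₂)⁻¹‖ ^ b *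
        R ^ (s₁.re + s₂.re) / (‖s₁‖ ^ (u + 1) * ‖s₂‖ ^ (v + 1))
      = (‖G s₁ s₂‖ * (‖zetaOne (s₁ + s₂)‖ / ‖s₁ + s₂‖) ^ d * ‖(zetaOne s₁)⁻¹‖ ^ a * ‖(zetaOne s₂)⁻¹‖ ^ b) *
        (R ^ (s₁.re + s₂.re) / (‖s₁‖ ^ (u + 1) * ‖s₂‖ ^ (v + 1))) := by ring
    _ ≤ (BG * Z ^ d * (A₁ / ‖s₁‖) ^ a * (A₂ / ‖s₂‖) ^ b) *
        (R ^ (s₁.re + s₂.re) / (‖s₁‖ ^ (u + 1) * ‖s₂‖ ^ (v + 1))) :=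
        mul_le_mul_of_nonneg_right hN hrest
    _ = BG * Z ^ d * A₁ ^ a * A₂ ^ b * R ^ (s₁.re + s₂.re) *
        ((‖s₁‖ ^ (u + 1 + a))⁻¹ * (‖s₂‖ ^ (v + 1 + b))⁻¹) := by
        have hn1' : ‖s₁‖ ≠ 0 := hn1.ne'
        have hn2' : ‖s₂‖ ≠ 0 := hn2.ne'
        simp only [div_pow, pow_add]
        field_simp

/-- The zero-free package at a point: `W(z) ≠ 0`, `|W(z)⁻¹| ≤ C log(Y+3)/|z|` and
`|W(z)|/|z| ≤ 1/|z| + C log(Y+3)` for `z ≠ 0`, `|Im z| ≤ Y`, `Re z ≥ −4c̄/log(Y+3)`.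
[cite: GoldstonPintzYildirim2009, Section 5 eq. 5.4] -/
theorem zetaOne_bounds_of_height_le
    (hWz : ∀ z : ℂ, z ≠ 0 → -(4 * cbar / Real.log (|z.im| + 3)) ≤ z.re →
      zetaOne z ≠ 0 ∧ ‖(zetaOne z)⁻¹‖ ≤ C * Real.log (|z.im| + 3) / ‖z‖ ∧
        ‖zetaOne z‖ ≤ 1 + C * ‖z‖ * Real.log (|z.im| + 3))
    (hc : 0 ≤ cbar) (hC : 0 ≤ C) {Y : ℝ} {z : ℂ} (hz : z ≠ 0) (hY : |z.im| ≤ Y)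
    (hσ : -(4 * cbar / Real.log (Y + 3)) ≤ z.re) :
    zetaOne z ≠ 0 ∧ ‖(zetaOne z)⁻¹‖ ≤ C * Real.log (Y + 3) / ‖z‖ ∧
      ‖zetaOne z‖ / ‖z‖ ≤ 1 / ‖z‖ + C * Real.log (Y + 3) := by
  obtain ⟨hne, hinv, hle⟩ := hWz z hz (region_of_height_le hc hY hσ)
  have hn : 0 < ‖z‖ := norm_pos_iff.2 hz
  have hL1 : 1 < Real.log (|z.im| + 3) :=
    Literature.NumberTheory.LFunctions.ZetaClassicalRegion.one_lt_log_abs_add_three z.im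
  have hlog : Real.log (|z.im| + 3) ≤ Real.log (Y + 3) :=
    Real.log_le_log (by linarith [abs_nonneg z.im]) (by linarith)
  refine ⟨hne, hinv.trans ?_, ?_⟩
  · exact div_le_div_of_nonneg_right (mul_le_mul_of_nonneg_left hlog hC) hn.le
  · rw [div_le_iff₀ hn]
    refine hle.trans ?_
    rw [add_mul, one_div_mul_cancel hn.ne']
    have : C * ‖z‖ * Real.log (|z.im| + 3) ≤ C * Real.log (Y + 3) * ‖z‖ := by
      have := mul_le_mul_of_nonneg_left hlog (mul_nonneg hC hn.le)
      linarith [this]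
    linarith

/-! ### Bounds for the pieces of the inner decomposition

Standing assumptions: `s₂ = θ₂ + it₂` with `0 < θ₂ ≤ 1`, `|t₂| ≤ T`; `T ≥ 1`; `R ≥ 1`; the
zero-free constants `c̄, C ≥ 0`; `|G| ≤ B` for `−κ ≤ Re sᵢ ≤ 2`. -/

/-- **Left edge, pointwise**: for `w = −σ_w + iτ`, `|τ| ≤ T_w`, with `0 < σ_w`,
`σ_w + θ₂ ≤ 4c̄/log(T_w + T + 3)`, `σ_w ≤ 4c̄/log(T_w + 3)`, `σ_w + θ₂ ≤ κ`, `σ_w + θ₂ < 1/4`: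
`|g(w)| ≤ B (1/σ_w + Cℓ)^d (Cℓ)^a (Cℓ)^b R^{−σ_w} / (|w−s₂|^{u+1+a} |s₂|^{v+1+b})`, `ℓ = log(T_w+T+3)`.
[cite: GoldstonPintzYildirim2009, Section 8 eq. 8.19] -/
theorem norm_lemma3g_left_le
    (hWz : ∀ z : ℂ, z ≠ 0 → -(4 * cbar / Real.log (|z.im| + 3)) ≤ z.re →
      zetaOne z ≠ 0 ∧ ‖(zetaOne z)⁻¹‖ ≤ C * Real.log (|z.im| + 3) / ‖z‖ ∧
        ‖zetaOne z‖ ≤ 1 + C * ‖z‖ * Real.log (|z.im| + 3))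
    (hc : 0 ≤ cbar) (hC : 0 ≤ C) {B κ : ℝ} (hB0 : 0 ≤ B)
    (hGB : ∀ s₁ s₂ : ℂ, -κ ≤ s₁.re → s₁.re ≤ 2 → -κ ≤ s₂.re → s₂.re ≤ 2 → ‖G s₁ s₂‖ ≤ B)
    {R : ℝ} (hR : 1 ≤ R) (a b d u v : ℕ) {σw Tw T : ℝ} {s₂ : ℂ} (hs₂ : 0 < s₂.re)
    (ht₂ : |s₂.im| ≤ T) (hT : 0 ≤ T) (hTw : T ≤ Tw) (hσw : 0 < σw)
    (hzfr : σw + s₂.re ≤ 4 * cbar / Real.log (Tw + T + 3)) (hκ : σw + s₂.re ≤ κ)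
    (hquarter : σw + s₂.re < 1 / 4) {τ : ℝ} (hτ : |τ| ≤ Tw) :
    ‖lemma3g G R a b d u v s₂ (((-σw : ℝ) : ℂ) + τ * I)‖ ≤
      B * (1 / σw + C * Real.log (Tw + T + 3)) ^ d * (C * Real.log (Tw + T + 3)) ^ a *
        (C * Real.log (Tw + T + 3)) ^ b * R ^ (-σw) *
        ((‖(((-σw : ℝ) : ℂ) + τ * I) - s₂‖ ^ (u + 1 + a))⁻¹ * (‖s₂‖ ^ (v + 1 + b))⁻¹) := by
  set w : ℂ := ((-σw : ℝ) : ℂ) + τ * I with hwdef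
  set s₁ : ℂ := w - s₂ with hs₁def
  have hwre : w.re = -σw := by simp [hwdef]
  have hwim : w.im = τ := by simp [hwdef]
  have hw0 : w ≠ 0 := fun h => by have := congrArg Complex.re h; rw [hwre] at this; simp at this; linarith
  have hs2ne : s₂ ≠ 0 := fun h => by rw [h] at hs₂; simp at hs₂
  have hs1re : s₁.re = -σw - s₂.re := by rw [hs₁def, sub_re, hwre]
  have hs1im : s₁.im = τ - s₂.im := by rw [hs₁def, sub_im, hwim]
  have hs1ne : s₁ ≠ 0 := fun h => by
    have := congrArg Complex.re h; rw [hs1re] at this; simp at this; linarith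
  have hlog3 : 0 < Real.log (Tw + T + 3) := Real.log_pos (by linarith)
  have hlog3' : 0 < Real.log (Tw + 3) := Real.log_pos (by linarith)
  -- `W(w)`: region at height `Tw`
  have hwY : |w.im| ≤ Tw + T := by rw [hwim]; linarith [hτ]
  have hσreg : -(4 * cbar / Real.log (Tw + T + 3)) ≤ -σw := by linarith
  obtain ⟨hWw, -, hZw⟩ := zetaOne_bounds_of_height_le hWz hc hC hw0 hwY (by rw [hwre]; exact hσreg)
  -- `W(s₁)`: height `Tw + T`
  have hs1Y : |s₁.im| ≤ Tw + T := by
    rw [hs1im]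
    calc |τ - s₂.im| ≤ |τ| + |s₂.im| := abs_sub _ _
      _ ≤ Tw + T := by linarith
  obtain ⟨hW1, hA1, -⟩ := zetaOne_bounds_of_height_le hWz hc hC hs1ne hs1Y (by rw [hs1re]; linarith)
  -- `W(s₂)`: height `T ≤ Tw + T`
  have hs2Y : |s₂.im| ≤ Tw + T := by linarith
  obtain ⟨hW2, hA2, -⟩ := zetaOne_bounds_of_height_le hWz hc hC hs2ne hs2Y (by
    have : (0 : ℝ) ≤ 4 * cbar / Real.log (Tw + T + 3) := by positivity
    linarith)
  have h12 : s₁ + s₂ = w := by rw [hs₁def, sub_add_cancel]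
  have hGB' : ‖G s₁ s₂‖ ≤ B := hGB s₁ s₂ (by rw [hs1re]; linarith) (by rw [hs1re]; linarith)
    (by linarith) (by linarith)
  have hZ : ‖zetaOne (s₁ + s₂)‖ / ‖s₁ + s₂‖ ≤ 1 / σw + C * Real.log (Tw + T + 3) := by
    rw [h12]
    refine hZw.trans ?_
    have hnw : σw ≤ ‖w‖ := by
      have := Complex.abs_re_le_norm w; rw [hwre, abs_neg, abs_of_pos hσw] at this; exact this
    have : 1 / ‖w‖ ≤ 1 / σw := one_div_le_one_div_of_le hσw hnw
    linarith
  have hmaster := norm_lemma3F_le_master (G := G) (R := R) (by linarith) a b d u v hs1ne hs2ne (by rw [h12]; exact hw0)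
    hW1 hW2 hB0 (by positivity) (by positivity) hGB' hZ hA1 hA2
  have hre : s₁.re + s₂.re = -σw := by linarith [hs1re]
  rw [hre] at hmaster
  change ‖lemma3F G R a b d u v (w - s₂) s₂‖ ≤ _
  exact hmaster

/-- **Left edge, integrated**: with the hypotheses of `norm_lemma3g_left_le` and `a + u ≥ 1`,
`‖∫_{−T_w}^{T_w} g(−σ_w+iτ) dτ‖ ≤ B (1/σ_w + Cℓ)^d (Cℓ)^{a} (Cℓ)^b R^{−σ_w} · π/(σ_w+θ₂)^{u+a} / |s₂|^{v+1+b}`.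
[cite: GoldstonPintzYildirim2009, Section 8 eq. 8.19] -/
theorem norm_integral_lemma3g_left_le
    (hWz : ∀ z : ℂ, z ≠ 0 → -(4 * cbar / Real.log (|z.im| + 3)) ≤ z.re →
      zetaOne z ≠ 0 ∧ ‖(zetaOne z)⁻¹‖ ≤ C * Real.log (|z.im| + 3) / ‖z‖ ∧
        ‖zetaOne z‖ ≤ 1 + C * ‖z‖ * Real.log (|z.im| + 3))
    (hc : 0 ≤ cbar) (hC : 0 ≤ C) {B κ : ℝ} (hB0 : 0 ≤ B)
    (hGB : ∀ s₁ s₂ : ℂ, -κ ≤ s₁.re → s₁.re ≤ 2 → -κ ≤ s₂.re → s₂.re ≤ 2 → ‖G s₁ s₂‖ ≤ B)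
    {R : ℝ} (hR : 1 ≤ R) {a b d u v : ℕ} (hau : 1 ≤ a + u) {σw Tw T : ℝ} {s₂ : ℂ} (hs₂ : 0 < s₂.re)
    (ht₂ : |s₂.im| ≤ T) (hT : 0 ≤ T) (hTw : T ≤ Tw) (hσw : 0 < σw)
    (hzfr : σw + s₂.re ≤ 4 * cbar / Real.log (Tw + T + 3)) (hκ : σw + s₂.re ≤ κ)
    (hquarter : σw + s₂.re < 1 / 4) :
    ‖∫ τ : ℝ in (-Tw)..Tw, lemma3g G R a b d u v s₂ (((-σw : ℝ) : ℂ) + τ * I)‖ ≤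
      B * (1 / σw + C * Real.log (Tw + T + 3)) ^ d * (C * Real.log (Tw + T + 3)) ^ a *
        (C * Real.log (Tw + T + 3)) ^ b * R ^ (-σw) * (Real.pi / (σw + s₂.re) ^ (u + a)) *
        (‖s₂‖ ^ (v + 1 + b))⁻¹ := by
  set K : ℝ := B * (1 / σw + C * Real.log (Tw + T + 3)) ^ d * (C * Real.log (Tw + T + 3)) ^ a *
    (C * Real.log (Tw + T + 3)) ^ b * R ^ (-σw) with hKdef
  have hlog3 : 0 < Real.log (Tw + T + 3) := Real.log_pos (by linarith)
  have hK0 : 0 ≤ K := by rw [hKdef]; positivity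
  -- the majorant `K (‖s₂‖^{v+1+b})⁻¹ / ‖(σw+θ₂) + i(τ - t₂)‖^{u+a+1}`
  set σ' : ℝ := σw + s₂.re with hσ'
  have hσ'0 : 0 < σ' := by rw [hσ']; linarith
  obtain ⟨hint, hval⟩ := integral_inv_norm_pow_le hσ'0 (k := u + a) (by omega)
  have hnorm_eq : ∀ τ : ℝ, ‖(((-σw : ℝ) : ℂ) + τ * I) - s₂‖ = ‖(σ' : ℂ) + ((τ - s₂.im : ℝ) : ℂ) * I‖ := by
    intro τ
    have hsq : ‖(((-σw : ℝ) : ℂ) + τ * I) - s₂‖ ^ 2 = ‖(σ' : ℂ) + ((τ - s₂.im : ℝ) : ℂ) * I‖ ^ 2 := by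
      rw [Complex.sq_norm, Complex.sq_norm, Complex.normSq_apply, Complex.normSq_apply]
      simp [hσ']
      ring
    rw [← Real.sqrt_sq (norm_nonneg ((((-σw : ℝ) : ℂ) + τ * I) - s₂)), hsq,
      Real.sqrt_sq (norm_nonneg _)]
  have hpt : ∀ τ : ℝ, τ ∈ Set.Ioc (-Tw) Tw →
      ‖lemma3g G R a b d u v s₂ (((-σw : ℝ) : ℂ) + τ * I)‖ ≤
        K * (‖s₂‖ ^ (v + 1 + b))⁻¹ * (‖(σ' : ℂ) + ((τ - s₂.im : ℝ) : ℂ) * I‖ ^ (u + a + 1))⁻¹ := by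
    intro τ hτ
    have hτ' : |τ| ≤ Tw := abs_le.2 ⟨hτ.1.le, hτ.2⟩
    have h := norm_lemma3g_left_le hWz hc hC hB0 hGB hR a b d u v hs₂ ht₂ hT hTw hσw hzfr hκ
      hquarter hτ'
    rw [hnorm_eq τ, show u + 1 + a = u + a + 1 by ring] at h
    refine h.trans (le_of_eq ?_)
    rw [hKdef]; ring
  have hTw0 : -Tw ≤ Tw := by linarith
  calc ‖∫ τ : ℝ in (-Tw)..Tw, lemma3g G R a b d u v s₂ (((-σw : ℝ) : ℂ) + τ * I)‖
      ≤ ∫ τ : ℝ in (-Tw)..Tw, K * (‖s₂‖ ^ (v + 1 + b))⁻¹ *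
          (‖(σ' : ℂ) + ((τ - s₂.im : ℝ) : ℂ) * I‖ ^ (u + a + 1))⁻¹ := by
        refine intervalIntegral.norm_integral_le_of_norm_le hTw0 (Eventually.of_forall ?_) ?_
        · intro τ hτ; exact hpt τ hτ
        · exact ((hint.comp_sub_right s₂.im).const_mul _).intervalIntegrable
    _ ≤ ∫ τ : ℝ, K * (‖s₂‖ ^ (v + 1 + b))⁻¹ * (‖(σ' : ℂ) + ((τ - s₂.im : ℝ) : ℂ) * I‖ ^ (u + a + 1))⁻¹ := by
        rw [intervalIntegral.integral_of_le hTw0]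
        exact setIntegral_le_integral ((hint.comp_sub_right s₂.im).const_mul _)
          (Eventually.of_forall fun τ => by positivity)
    _ = K * (‖s₂‖ ^ (v + 1 + b))⁻¹ * ∫ τ : ℝ, (‖(σ' : ℂ) + (τ : ℂ) * I‖ ^ (u + a + 1))⁻¹ := by
        rw [MeasureTheory.integral_const_mul]
        congr 1
        exact integral_sub_right_eq_self (fun τ : ℝ => (‖(σ' : ℂ) + (τ : ℂ) * I‖ ^ (u + a + 1))⁻¹) s₂.im
    _ ≤ K * (‖s₂‖ ^ (v + 1 + b))⁻¹ * (Real.pi / σ' ^ (u + a)) :=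
        mul_le_mul_of_nonneg_left hval (by positivity)
    _ = _ := by rw [hKdef]; ring

/-- **Top/bottom edges, pointwise**: for `w = x ± iT_w`, `x ∈ [−σ_w, θ + Re s₂]` (`θ ≤ 1`), with
`T_w ≥ T + 1`, `T_w ≥ 1`, and the hypotheses of `norm_lemma3g_left_le`:
`|g(w)| ≤ B (1/σ_w + Cℓ)^d (Cℓ)^a (Cℓ)^b R^{θ+Re s₂} / ((T_w − T)^{u+1+a} |s₂|^{v+1+b})`.
[cite: GoldstonPintzYildirim2009, Section 8 eq. 8.19] -/
theorem norm_lemma3g_horizontal_le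
    (hWz : ∀ z : ℂ, z ≠ 0 → -(4 * cbar / Real.log (|z.im| + 3)) ≤ z.re →
      zetaOne z ≠ 0 ∧ ‖(zetaOne z)⁻¹‖ ≤ C * Real.log (|z.im| + 3) / ‖z‖ ∧
        ‖zetaOne z‖ ≤ 1 + C * ‖z‖ * Real.log (|z.im| + 3))
    (hc : 0 ≤ cbar) (hC : 0 ≤ C) {B κ : ℝ} (hB0 : 0 ≤ B)
    (hGB : ∀ s₁ s₂ : ℂ, -κ ≤ s₁.re → s₁.re ≤ 2 → -κ ≤ s₂.re → s₂.re ≤ 2 → ‖G s₁ s₂‖ ≤ B)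
    {R : ℝ} (hR : 1 ≤ R) (a b d u v : ℕ) {θ σw Tw T : ℝ} {s₂ : ℂ} (hs₂ : 0 < s₂.re)
    (hθ1 : θ ≤ 1) (ht₂ : |s₂.im| ≤ T) (hT : 0 ≤ T) (hTw : T + 1 ≤ Tw) (hσw : 0 < σw)
    (hzfr : σw + s₂.re ≤ 4 * cbar / Real.log (Tw + T + 3)) (hκ : σw + s₂.re ≤ κ)
    (hquarter : σw + s₂.re < 1 / 4) {x Y : ℝ} (hx : -σw ≤ x) (hx' : x ≤ θ + s₂.re) (hY : |Y| = Tw) :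
    ‖lemma3g G R a b d u v s₂ ((x : ℂ) + Y * I)‖ ≤
      B * (1 / σw + C * Real.log (Tw + T + 3)) ^ d * (C * Real.log (Tw + T + 3)) ^ a *
        (C * Real.log (Tw + T + 3)) ^ b * R ^ (θ + s₂.re) *
        (((Tw - T) ^ (u + 1 + a))⁻¹ * (‖s₂‖ ^ (v + 1 + b))⁻¹) := by
  set w : ℂ := (x : ℂ) + Y * I with hwdef
  set s₁ : ℂ := w - s₂ with hs₁def
  have hwre : w.re = x := by simp [hwdef]
  have hwim : w.im = Y := by simp [hwdef]
  have hTw1 : 1 ≤ Tw := by linarith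
  have hY0 : Y ≠ 0 := fun h => by rw [h, abs_zero] at hY; linarith
  have hw0 : w ≠ 0 := fun h => by have := congrArg Complex.im h; rw [hwim] at this; simp at this; exact hY0 this
  have hs2ne : s₂ ≠ 0 := fun h => by rw [h] at hs₂; simp at hs₂
  have hs1re : s₁.re = x - s₂.re := by rw [hs₁def, sub_re, hwre]
  have hs1im : s₁.im = Y - s₂.im := by rw [hs₁def, sub_im, hwim]
  -- `|Im s₁| ≥ Tw − T`
  have hs1im_ge : Tw - T ≤ |s₁.im| := by
    rw [hs1im]
    have h1 : |Y| - |s₂.im| ≤ |Y - s₂.im| := abs_sub_abs_le_abs_sub Y s₂.im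
    rw [hY] at h1
    linarith
  have hTwT : 0 < Tw - T := by linarith
  have hs1ne : s₁ ≠ 0 := fun h => by
    have := congrArg Complex.im h; simp at this; rw [this, abs_zero] at hs1im_ge; linarith
  have hlog3 : 0 < Real.log (Tw + T + 3) := Real.log_pos (by linarith)
  -- regions
  have hσreg : -(4 * cbar / Real.log (Tw + T + 3)) ≤ -σw := by linarith
  have hwY : |w.im| ≤ Tw + T := by rw [hwim, hY]; linarith
  obtain ⟨hWw, -, hZw⟩ := zetaOne_bounds_of_height_le hWz hc hC hw0 hwY (by rw [hwre]; linarith)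
  have hs1Y : |s₁.im| ≤ Tw + T := by
    rw [hs1im]
    calc |Y - s₂.im| ≤ |Y| + |s₂.im| := abs_sub _ _
      _ ≤ Tw + T := by rw [hY]; linarith
  obtain ⟨hW1, hA1, -⟩ := zetaOne_bounds_of_height_le hWz hc hC hs1ne hs1Y (by rw [hs1re]; linarith)
  have hs2Y : |s₂.im| ≤ Tw + T := by linarith
  obtain ⟨hW2, hA2, -⟩ := zetaOne_bounds_of_height_le hWz hc hC hs2ne hs2Y (by
    have : (0 : ℝ) ≤ 4 * cbar / Real.log (Tw + T + 3) := by positivity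
    linarith)
  have h12 : s₁ + s₂ = w := by rw [hs₁def, sub_add_cancel]
  have hGB' : ‖G s₁ s₂‖ ≤ B := hGB s₁ s₂ (by rw [hs1re]; linarith) (by rw [hs1re]; linarith)
    (by linarith) (by linarith)
  have hZ : ‖zetaOne (s₁ + s₂)‖ / ‖s₁ + s₂‖ ≤ 1 / σw + C * Real.log (Tw + T + 3) := by
    rw [h12]
    refine hZw.trans ?_
    have hnw : Tw ≤ ‖w‖ := by
      have := Complex.abs_im_le_norm w; rw [hwim, hY] at this; exact this
    have : 1 / ‖w‖ ≤ 1 / σw := one_div_le_one_div_of_le hσw (by linarith)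
    linarith
  have hmaster := norm_lemma3F_le_master (G := G) (R := R) (by linarith) a b d u v hs1ne hs2ne
    (by rw [h12]; exact hw0) hW1 hW2 hB0 (by positivity) (by positivity) hGB' hZ hA1 hA2
  have hre : s₁.re + s₂.re = x := by linarith [hs1re]
  rw [hre] at hmaster
  change ‖lemma3F G R a b d u v (w - s₂) s₂‖ ≤ _
  refine hmaster.trans ?_
  -- `R^x ≤ R^{θ+θ₂}` and `‖s₁‖ ≥ Tw − T`
  have hRx : R ^ x ≤ R ^ (θ + s₂.re) := Real.rpow_le_rpow_of_exponent_le hR hx'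
  have hns1 : Tw - T ≤ ‖s₁‖ := hs1im_ge.trans (Complex.abs_im_le_norm s₁)
  have hpow : ((‖s₁‖ ^ (u + 1 + a))⁻¹) ≤ ((Tw - T) ^ (u + 1 + a))⁻¹ :=
    inv_anti₀ (by positivity) (pow_le_pow_left₀ hTwT.le hns1 _)
  have hK0 : 0 ≤ B * (1 / σw + C * Real.log (Tw + T + 3)) ^ d * (C * Real.log (Tw + T + 3)) ^ a *
      (C * Real.log (Tw + T + 3)) ^ b := by positivity
  change ‖lemma3F G R a b d u v s₁ s₂‖ ≤ _ at hmaster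
  gcongr

/-- **Horizontal edges, integrated**: `‖∫_{−σ_w}^{θ+Re s₂} g(x ± iT_w) dx‖ ≤ (θ + Re s₂ + σ_w) ·` the
pointwise bound of `norm_lemma3g_horizontal_le`. [cite: GoldstonPintzYildirim2009, Section 8 eq. 8.19] -/
theorem norm_integral_lemma3g_horizontal_le
    (hWz : ∀ z : ℂ, z ≠ 0 → -(4 * cbar / Real.log (|z.im| + 3)) ≤ z.re →
      zetaOne z ≠ 0 ∧ ‖(zetaOne z)⁻¹‖ ≤ C * Real.log (|z.im| + 3) / ‖z‖ ∧
        ‖zetaOne z‖ ≤ 1 + C * ‖z‖ * Real.log (|z.im| + 3))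
    (hc : 0 ≤ cbar) (hC : 0 ≤ C) {B κ : ℝ} (hB0 : 0 ≤ B)
    (hGB : ∀ s₁ s₂ : ℂ, -κ ≤ s₁.re → s₁.re ≤ 2 → -κ ≤ s₂.re → s₂.re ≤ 2 → ‖G s₁ s₂‖ ≤ B)
    {R : ℝ} (hR : 1 ≤ R) (a b d u v : ℕ) {θ σw Tw T : ℝ} {s₂ : ℂ} (hs₂ : 0 < s₂.re)
    (hθ0 : 0 ≤ θ) (hθ1 : θ ≤ 1) (ht₂ : |s₂.im| ≤ T) (hT : 0 ≤ T) (hTw : T + 1 ≤ Tw) (hσw : 0 < σw)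
    (hzfr : σw + s₂.re ≤ 4 * cbar / Real.log (Tw + T + 3)) (hκ : σw + s₂.re ≤ κ)
    (hquarter : σw + s₂.re < 1 / 4) {Y : ℝ} (hY : |Y| = Tw) :
    ‖∫ x : ℝ in (-σw)..(θ + s₂.re), lemma3g G R a b d u v s₂ ((x : ℂ) + Y * I)‖ ≤
      (θ + s₂.re + σw) * (B * (1 / σw + C * Real.log (Tw + T + 3)) ^ d * (C * Real.log (Tw + T + 3)) ^ a *
        (C * Real.log (Tw + T + 3)) ^ b * R ^ (θ + s₂.re) *
        (((Tw - T) ^ (u + 1 + a))⁻¹ * (‖s₂‖ ^ (v + 1 + b))⁻¹)) := by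
  have hab : -σw ≤ θ + s₂.re := by linarith
  have h := intervalIntegral.norm_integral_le_of_norm_le_const (a := -σw) (b := θ + s₂.re)
    (f := fun x : ℝ => lemma3g G R a b d u v s₂ ((x : ℂ) + Y * I))
    (C := B * (1 / σw + C * Real.log (Tw + T + 3)) ^ d * (C * Real.log (Tw + T + 3)) ^ a *
        (C * Real.log (Tw + T + 3)) ^ b * R ^ (θ + s₂.re) *
        (((Tw - T) ^ (u + 1 + a))⁻¹ * (‖s₂‖ ^ (v + 1 + b))⁻¹)) (fun x hx => by
      rw [uIoc_of_le hab] at hx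
      exact norm_lemma3g_horizontal_le hWz hc hC hB0 hGB hR a b d u v hs₂ hθ1 ht₂ hT hTw hσw
        hzfr hκ hquarter hx.1.le hx.2 hY)
  rw [abs_of_nonneg (by linarith : (0 : ℝ) ≤ θ + s₂.re - -σw)] at h
  refine h.trans (le_of_eq ?_)
  ring

/-- **Tails, pointwise**: on `Re w = c = θ + Re s₂` (`0 < θ ≤ 1`), for `|τ| ≥ T_w ≥ 2T`, `T_w ≥ 2`:
`|g(c+iτ)| ≤ M/τ²` with `M = B (3/c)^d (2/θ)^a (C log(T_w+T+3))^b R^c 2^{u+1+a} / |s₂|^{v+1+b}`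
(elementary bounds for `W(w)`, `W(w−s₂)` in `Re > 0`; `|w − s₂| ≥ |τ| − T ≥ |τ|/2`; `a + u ≥ 1`).
[cite: GoldstonPintzYildirim2009, Section 8 eq. 8.19] -/
theorem norm_lemma3g_tail_le
    (hWz : ∀ z : ℂ, z ≠ 0 → -(4 * cbar / Real.log (|z.im| + 3)) ≤ z.re →
      zetaOne z ≠ 0 ∧ ‖(zetaOne z)⁻¹‖ ≤ C * Real.log (|z.im| + 3) / ‖z‖ ∧
        ‖zetaOne z‖ ≤ 1 + C * ‖z‖ * Real.log (|z.im| + 3))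
    (hc : 0 ≤ cbar) (hC : 0 ≤ C) {B κ : ℝ} (hB0 : 0 ≤ B) (hκ0 : 0 ≤ κ)
    (hGB : ∀ s₁ s₂ : ℂ, -κ ≤ s₁.re → s₁.re ≤ 2 → -κ ≤ s₂.re → s₂.re ≤ 2 → ‖G s₁ s₂‖ ≤ B)
    {R : ℝ} (hR : 1 ≤ R) {a b d u v : ℕ} (hau : 1 ≤ a + u) {θ Tw T : ℝ} {s₂ : ℂ} (hs₂ : 0 < s₂.re)
    (hs₂1 : s₂.re ≤ 1) (hθ : 0 < θ) (hθ1 : θ ≤ 1) (ht₂ : |s₂.im| ≤ T) (hT : 1 ≤ T) (hTw : 2 * T ≤ Tw)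
    {τ : ℝ} (hτ : Tw ≤ |τ|) :
    ‖lemma3g G R a b d u v s₂ (((θ + s₂.re : ℝ) : ℂ) + τ * I)‖ ≤
      (B * (3 / (θ + s₂.re)) ^ d * (2 / θ) ^ a * (C * Real.log (Tw + T + 3)) ^ b * R ^ (θ + s₂.re) *
        2 ^ (u + 1 + a) * (‖s₂‖ ^ (v + 1 + b))⁻¹) / τ ^ 2 := by
  set c : ℝ := θ + s₂.re with hcdef
  set w : ℂ := (c : ℂ) + τ * I with hwdef
  set s₁ : ℂ := w - s₂ with hs₁def
  have hc0 : 0 < c := by rw [hcdef]; linarith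
  have hwre : w.re = c := by simp [hwdef]
  have hwim : w.im = τ := by simp [hwdef]
  have hτ1 : 2 ≤ |τ| := by linarith
  have hw0 : w ≠ 0 := fun h => by have := congrArg Complex.re h; rw [hwre] at this; simp at this; linarith
  have hs2ne : s₂ ≠ 0 := fun h => by rw [h] at hs₂; simp at hs₂
  have hs1re : s₁.re = θ := by rw [hs₁def, sub_re, hwre, hcdef]; ring
  have hs1im : s₁.im = τ - s₂.im := by rw [hs₁def, sub_im, hwim]
  have hs1re0 : 0 < s₁.re := by rw [hs1re]; exact hθ
  have hs1ne : s₁ ≠ 0 := fun h => by rw [h] at hs1re0; simp at hs1re0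
  have h12 : s₁ + s₂ = w := by rw [hs₁def, sub_add_cancel]
  -- `‖s₁‖ ≥ |τ| − T ≥ |τ|/2`
  have hs1n : |τ| / 2 ≤ ‖s₁‖ := by
    have h1 : |τ| - |s₂.im| ≤ |τ - s₂.im| := abs_sub_abs_le_abs_sub τ s₂.im
    have h2 : |s₁.im| ≤ ‖s₁‖ := Complex.abs_im_le_norm s₁
    rw [hs1im] at h2
    linarith
  have hτ0 : 0 < |τ| := by linarith
  -- the elementary `W`-bounds in `Re > 0`
  have hW1 := zetaOne_ne_zero_of_re_pos hs1re0
  have hW2 := zetaOne_ne_zero_of_re_pos hs₂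
  have hZ : ‖zetaOne (s₁ + s₂)‖ / ‖s₁ + s₂‖ ≤ 3 / c := by
    rw [h12]
    have hwre0 : 0 < w.re := by rw [hwre]; exact hc0
    rw [div_le_iff₀ (norm_pos_iff.2 hw0)]
    refine (norm_zetaOne_le_of_re_pos hwre0).trans ?_
    rw [hwre, div_mul_eq_mul_div, div_mul_eq_mul_div]
    refine div_le_div_of_nonneg_right ?_ hc0.le
    have : c ≤ 2 := by rw [hcdef]; linarith
    nlinarith [norm_nonneg w]
  have hA1 : ‖(zetaOne s₁)⁻¹‖ ≤ (2 / θ) / ‖s₁‖ := by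
    refine (norm_inv_zetaOne_le_of_re_pos hs1re0).trans ?_
    rw [hs1re, div_div]
    exact div_le_div_of_nonneg_right (by linarith) (by positivity)
  -- `W(s₂)⁻¹` by the zero-free bound (a log instead of `1/θ₂`)
  have hs2Y : |s₂.im| ≤ Tw + T := by linarith
  have hlog3 : 0 < Real.log (Tw + T + 3) := Real.log_pos (by linarith)
  obtain ⟨-, hA2, -⟩ := zetaOne_bounds_of_height_le hWz hc hC hs2ne hs2Y (by
    have : (0 : ℝ) ≤ 4 * cbar / Real.log (Tw + T + 3) := by positivity
    linarith)
  have hGB' : ‖G s₁ s₂‖ ≤ B := hGB s₁ s₂ (by rw [hs1re]; linarith) (by rw [hs1re]; linarith)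
    (by linarith) (by linarith)
  have hmaster := norm_lemma3F_le_master (G := G) (R := R) (by linarith) a b d u v hs1ne hs2ne
    (by rw [h12]; exact hw0) hW1 hW2 hB0 (by positivity) (by positivity) hGB' hZ hA1 hA2
  have hre : s₁.re + s₂.re = c := by rw [hs1re, hcdef]
  rw [hre] at hmaster
  change ‖lemma3F G R a b d u v (w - s₂) s₂‖ ≤ _
  refine hmaster.trans ?_
  change B * (3 / c) ^ d * (2 / θ) ^ a * (C * Real.log (Tw + T + 3)) ^ b * R ^ c *
      ((‖s₁‖ ^ (u + 1 + a))⁻¹ * (‖s₂‖ ^ (v + 1 + b))⁻¹) ≤ _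
  -- `1/‖s₁‖^{u+1+a} ≤ 2^{u+1+a}/|τ|^{u+1+a} ≤ 2^{u+1+a}/τ²`
  have hpow1 : (‖s₁‖ ^ (u + 1 + a))⁻¹ ≤ 2 ^ (u + 1 + a) / |τ| ^ (u + 1 + a) := by
    calc (‖s₁‖ ^ (u + 1 + a))⁻¹ ≤ ((|τ| / 2) ^ (u + 1 + a))⁻¹ :=
          inv_anti₀ (by positivity) (pow_le_pow_left₀ (by positivity) hs1n _)
      _ = 2 ^ (u + 1 + a) / |τ| ^ (u + 1 + a) := by rw [div_pow, inv_div]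
  have hpow2 : |τ| ^ 2 ≤ |τ| ^ (u + 1 + a) := pow_le_pow_right₀ (by linarith) (by omega)
  have hpow3 : 2 ^ (u + 1 + a) / |τ| ^ (u + 1 + a) ≤ (2 : ℝ) ^ (u + 1 + a) / τ ^ 2 := by
    rw [← sq_abs τ]
    exact div_le_div_of_nonneg_left (by positivity) (by positivity) hpow2
  have hK0 : 0 ≤ B * (3 / c) ^ d * (2 / θ) ^ a * (C * Real.log (Tw + T + 3)) ^ b * R ^ c := by positivity
  calc B * (3 / c) ^ d * (2 / θ) ^ a * (C * Real.log (Tw + T + 3)) ^ b * R ^ c *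
        ((‖s₁‖ ^ (u + 1 + a))⁻¹ * (‖s₂‖ ^ (v + 1 + b))⁻¹)
      ≤ B * (3 / c) ^ d * (2 / θ) ^ a * (C * Real.log (Tw + T + 3)) ^ b * R ^ c *
        ((2 : ℝ) ^ (u + 1 + a) / τ ^ 2 * (‖s₂‖ ^ (v + 1 + b))⁻¹) := by
        gcongr
        exact hpow1.trans hpow3
    _ = _ := by rw [hcdef]; ring

/-- **Tails, integrated**: `‖∫_ℝ g(c+iτ)dτ − ∫_{−T_w}^{T_w} g(c+iτ)dτ‖ ≤ 2M/T_w` with `M` as in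
`norm_lemma3g_tail_le` (the line integral being absolutely convergent: it is the translate of
`∫ F(θ+it₁, s₂) dt₁`). [cite: GoldstonPintzYildirim2009, Section 8 eq. 8.19] -/
theorem norm_integral_lemma3g_tail_le
    (hWz : ∀ z : ℂ, z ≠ 0 → -(4 * cbar / Real.log (|z.im| + 3)) ≤ z.re →
      zetaOne z ≠ 0 ∧ ‖(zetaOne z)⁻¹‖ ≤ C * Real.log (|z.im| + 3) / ‖z‖ ∧
        ‖zetaOne z‖ ≤ 1 + C * ‖z‖ * Real.log (|z.im| + 3))
    (hc : 0 ≤ cbar) (hC : 0 ≤ C) {B κ : ℝ} (hB0 : 0 ≤ B) (hκ0 : 0 ≤ κ)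
    (hG : DifferentiableOn ℂ (fun z : ℂ × ℂ => G z.1 z.2) G₂Region)
    (hGB : ∀ s₁ s₂ : ℂ, -κ ≤ s₁.re → s₁.re ≤ 2 → -κ ≤ s₂.re → s₂.re ≤ 2 → ‖G s₁ s₂‖ ≤ B)
    {R : ℝ} (hR : 1 ≤ R) {a b d u v : ℕ} (hau : 1 ≤ a + u) {θ Tw T : ℝ} {s₂ : ℂ} (hs₂ : 0 < s₂.re)
    (hs₂1 : s₂.re ≤ 1) (hθ : 0 < θ) (hθ1 : θ ≤ 1) (ht₂ : |s₂.im| ≤ T) (hT : 1 ≤ T) (hTw : 2 * T ≤ Tw) :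
    ‖(∫ τ : ℝ, lemma3g G R a b d u v s₂ (((θ + s₂.re : ℝ) : ℂ) + τ * I)) -
        ∫ τ : ℝ in (-Tw)..Tw, lemma3g G R a b d u v s₂ (((θ + s₂.re : ℝ) : ℂ) + τ * I)‖ ≤
      2 * ((B * (3 / (θ + s₂.re)) ^ d * (2 / θ) ^ a * (C * Real.log (Tw + T + 3)) ^ b * R ^ (θ + s₂.re) *
        2 ^ (u + 1 + a) * (‖s₂‖ ^ (v + 1 + b))⁻¹) / Tw) := by
  have hTw0 : 0 < Tw := by linarith
  -- integrability of `τ ↦ g(c + iτ)`: translate of the integrable `t ↦ F(θ+it, s₂)`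
  have hint : Integrable fun τ : ℝ => lemma3g G R a b d u v s₂ (((θ + s₂.re : ℝ) : ℂ) + τ * I) := by
    have h1 : Integrable fun t : ℝ => lemma3F G R a b d u v ((θ : ℂ) + t * I) s₂ := by
      -- from the product majorant on the lines `Re s₁ = θ`, `Re s₂ = s₂.re`
      have hR0 : 0 < R := by linarith
      obtain ⟨hi, -⟩ := integral_inv_norm_pow_le hθ (k := u + a) (by omega)
      have hcont : Continuous fun t : ℝ => lemma3F G R a b d u v ((θ : ℂ) + t * I) s₂ := by
        have hc2 := continuous_lemma3F_lines hG hR0 a b d u v hθ hs₂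
        have : (fun t : ℝ => lemma3F G R a b d u v ((θ : ℂ) + t * I) s₂) =
            (fun p : ℝ × ℝ => lemma3F G R a b d u v ((θ : ℂ) + p.1 * I) (((s₂.re : ℝ) : ℂ) + p.2 * I)) ∘
              fun t => (t, s₂.im) := by
          funext t; simp only [Function.comp]; congr 1; apply Complex.ext <;> simp
        rw [this]; exact hc2.comp (by fun_prop)
      set K := B * lineConst θ s₂.re a b d * R ^ (θ + s₂.re) * (‖s₂‖ ^ (v + 1 + b))⁻¹ with hKdef
      refine (hi.const_mul K).mono' hcont.aestronglyMeasurable (Eventually.of_forall fun t => ?_)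
      have h := norm_lemma3F_le_of_re_pos (G := G) (B := B) hR0 a b d u v (s₁ := (θ : ℂ) + t * I)
        (s₂ := s₂) (by simp [hθ]) (by simp [hθ1]) hs₂ hs₂1 hB0
        (hGB _ _ (by simp; linarith) (by simp; linarith) (by linarith) (by linarith))
      simp only [Literature.NumberTheory.LFunctions.MertensBoundRH.re_line] at h
      rw [show u + 1 + a = u + a + 1 by ring] at h
      refine h.trans (le_of_eq ?_)
      rw [hKdef]; ring
    have h2 := h1.comp_sub_right s₂.im
    refine h2.congr (Eventually.of_forall fun τ => ?_)
    simp only [lemma3g]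
    congr 1
    apply Complex.ext <;> simp
  refine norm_integral_sub_intervalIntegral_le hint hTw0 fun τ hτ => ?_
  exact norm_lemma3g_tail_le hWz hc hC hB0 hκ0 hGB hR hau hs₂ hs₂1 hθ hθ1 ht₂ hT hTw hτ

/-- **The diagonal residue term, pointwise on `∂Q(0,η)`**: for `w` with `η ≤ |w| ≤ 2η`,
`|Re w|, |Im w| ≤ η`, and `s₂` with `4η ≤ Re s₂`,
`η + Re s₂ ≤ κ`, `η + Re s₂ < 1/4`, `η + Re s₂ ≤ 4c̄/log(|Im s₂| + η + 3)`, `2η ≤ ρ_W`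
(`|W| ≤ 3/2` on `|s| ≤ ρ_W`), `R ≥ 1`:
`|g_{s₂}(w)| ≤ B (3/(2η))^d (Cℓ₂)^a (Cℓ₂)^b R^η 2^{u+1+a} / |s₂|^{(u+1+a)+(v+1+b)}`,
`ℓ₂ = log(|Im s₂| + η + 3)`. [cite: GoldstonPintzYildirim2009, Section 8 eq. 8.24] -/
theorem norm_lemma3g_diag_le
    (hWz : ∀ z : ℂ, z ≠ 0 → -(4 * cbar / Real.log (|z.im| + 3)) ≤ z.re →
      zetaOne z ≠ 0 ∧ ‖(zetaOne z)⁻¹‖ ≤ C * Real.log (|z.im| + 3) / ‖z‖ ∧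
        ‖zetaOne z‖ ≤ 1 + C * ‖z‖ * Real.log (|z.im| + 3))
    (hc : 0 ≤ cbar) (hC : 0 ≤ C) {B κ ρW : ℝ} (hB0 : 0 ≤ B)
    (hGB : ∀ s₁ s₂ : ℂ, -κ ≤ s₁.re → s₁.re ≤ 2 → -κ ≤ s₂.re → s₂.re ≤ 2 → ‖G s₁ s₂‖ ≤ B)
    (hρ : ∀ s : ℂ, ‖s‖ ≤ ρW → 1 / 2 ≤ ‖zetaOne s‖ ∧ ‖zetaOne s‖ ≤ 3 / 2)
    {R : ℝ} (hR : 1 ≤ R) (a b d u v : ℕ) {η : ℝ} {s₂ w : ℂ} (hη : 0 < η) (hηρ : 2 * η ≤ ρW)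
    (hs₂ : 4 * η ≤ s₂.re) (hκ : η + s₂.re ≤ κ) (hquarter : η + s₂.re < 1 / 4)
    (hzfr : η + s₂.re ≤ 4 * cbar / Real.log (|s₂.im| + η + 3))
    (hwlo : η ≤ ‖w‖) (hwhi : ‖w‖ ≤ 2 * η) (hwre : |w.re| ≤ η) (hwim : |w.im| ≤ η) :
    ‖lemma3g G R a b d u v s₂ w‖ ≤
      B * (3 / (2 * η)) ^ d * (C * Real.log (|s₂.im| + η + 3)) ^ a *
        (C * Real.log (|s₂.im| + η + 3)) ^ b * R ^ η * 2 ^ (u + 1 + a) *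
        ((‖s₂‖ ^ (u + 1 + a))⁻¹ * (‖s₂‖ ^ (v + 1 + b))⁻¹) := by
  set s₁ : ℂ := w - s₂ with hs₁def
  have hs₂0 : 0 < s₂.re := by linarith
  have hw0 : w ≠ 0 := fun h => by rw [h, norm_zero] at hwlo; linarith
  have hs2ne : s₂ ≠ 0 := fun h => by rw [h] at hs₂0; simp at hs₂0
  have hns2 : 4 * η ≤ ‖s₂‖ := hs₂.trans ((abs_re_le_norm s₂).trans' (le_abs_self _))
  have hs1re : s₁.re = w.re - s₂.re := by rw [hs₁def, sub_re]
  have hs1im : s₁.im = w.im - s₂.im := by rw [hs₁def, sub_im]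
  have hwre' := abs_le.1 hwre
  have hwim' := abs_le.1 hwim
  -- `‖s₁‖ ≥ ‖s₂‖ − 2η ≥ ‖s₂‖/2`
  have hns1 : ‖s₂‖ / 2 ≤ ‖s₁‖ := by
    have h := norm_sub_norm_le s₂ w
    rw [← norm_neg (s₂ - w), neg_sub] at h
    linarith
  have hns1pos : 0 < ‖s₁‖ := by linarith
  have hs1ne : s₁ ≠ 0 := norm_pos_iff.1 hns1pos
  have h12 : s₁ + s₂ = w := by rw [hs₁def, sub_add_cancel]
  -- `W(w)`: `‖w‖ ≤ 2η ≤ ρ_W`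
  have hWw : ‖zetaOne w‖ ≤ 3 / 2 := (hρ w (hwhi.trans hηρ)).2
  have hZ : ‖zetaOne (s₁ + s₂)‖ / ‖s₁ + s₂‖ ≤ 3 / (2 * η) := by
    rw [h12, div_le_div_iff₀ (norm_pos_iff.2 hw0) (by positivity)]
    nlinarith [norm_nonneg (zetaOne w)]
  -- `W(s₁)`: zero-free region at height `|Im s₂| + η`
  have hs1Y : |s₁.im| ≤ |s₂.im| + η := by
    rw [hs1im]
    calc |w.im - s₂.im| ≤ |w.im| + |s₂.im| := abs_sub _ _
      _ ≤ |s₂.im| + η := by linarith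
  have hlog : 0 < Real.log (|s₂.im| + η + 3) := Real.log_pos (by linarith [abs_nonneg s₂.im])
  obtain ⟨hW1, hA1, -⟩ := zetaOne_bounds_of_height_le hWz hc hC hs1ne hs1Y (by rw [hs1re]; linarith)
  -- `W(s₂)`: `Re s₂ > 0`
  have hs2Y : |s₂.im| ≤ |s₂.im| + η := by linarith
  obtain ⟨hW2, hA2, -⟩ := zetaOne_bounds_of_height_le hWz hc hC hs2ne hs2Y (by
    have : (0 : ℝ) ≤ 4 * cbar / Real.log (|s₂.im| + η + 3) := by positivity
    linarith)
  have hGB' : ‖G s₁ s₂‖ ≤ B := hGB s₁ s₂ (by rw [hs1re]; linarith) (by rw [hs1re]; linarith)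
    (by linarith) (by linarith)
  have hmaster := norm_lemma3F_le_master (G := G) (R := R) (by linarith) a b d u v hs1ne hs2ne
    (by rw [h12]; exact hw0) hW1 hW2 hB0 (by positivity) (by positivity) hGB' hZ hA1 hA2
  have hre : s₁.re + s₂.re = w.re := by linarith [hs1re]
  rw [hre] at hmaster
  change ‖lemma3F G R a b d u v (w - s₂) s₂‖ ≤ _
  refine hmaster.trans ?_
  change B * (3 / (2 * η)) ^ d * (C * Real.log (|s₂.im| + η + 3)) ^ a *
      (C * Real.log (|s₂.im| + η + 3)) ^ b * R ^ w.re *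
      ((‖s₁‖ ^ (u + 1 + a))⁻¹ * (‖s₂‖ ^ (v + 1 + b))⁻¹) ≤ _
  have hRw : R ^ w.re ≤ R ^ η := Real.rpow_le_rpow_of_exponent_le hR hwre'.2
  have hpow : (‖s₁‖ ^ (u + 1 + a))⁻¹ ≤ 2 ^ (u + 1 + a) * (‖s₂‖ ^ (u + 1 + a))⁻¹ := by
    calc (‖s₁‖ ^ (u + 1 + a))⁻¹ ≤ ((‖s₂‖ / 2) ^ (u + 1 + a))⁻¹ :=
          inv_anti₀ (by positivity) (pow_le_pow_left₀ (by positivity) hns1 _)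
      _ = 2 ^ (u + 1 + a) * (‖s₂‖ ^ (u + 1 + a))⁻¹ := by rw [div_pow, inv_div, div_eq_mul_inv]
  have hK0 : 0 ≤ B * (3 / (2 * η)) ^ d * (C * Real.log (|s₂.im| + η + 3)) ^ a *
      (C * Real.log (|s₂.im| + η + 3)) ^ b := by positivity
  calc B * (3 / (2 * η)) ^ d * (C * Real.log (|s₂.im| + η + 3)) ^ a *
        (C * Real.log (|s₂.im| + η + 3)) ^ b * R ^ w.re *
        ((‖s₁‖ ^ (u + 1 + a))⁻¹ * (‖s₂‖ ^ (v + 1 + b))⁻¹)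
      ≤ B * (3 / (2 * η)) ^ d * (C * Real.log (|s₂.im| + η + 3)) ^ a *
        (C * Real.log (|s₂.im| + η + 3)) ^ b * R ^ η *
        ((2 ^ (u + 1 + a) * (‖s₂‖ ^ (u + 1 + a))⁻¹) * (‖s₂‖ ^ (v + 1 + b))⁻¹) := by gcongr
    _ = _ := by ring

/-- Points of the boundary of the square `[−η, η]²` satisfy `η ≤ |w| ≤ 2η`, `|Re w|, |Im w| ≤ η`.
[folklore] -/
theorem square_boundary_norms {η : ℝ} (hη : 0 < η) {w : ℂ}
    (h : (w.re ∈ Icc (-η) η ∧ (w.im = -η ∨ w.im = η)) ∨ (w.im ∈ Icc (-η) η ∧ (w.re = -η ∨ w.re = η))) :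
    η ≤ ‖w‖ ∧ ‖w‖ ≤ 2 * η ∧ |w.re| ≤ η ∧ |w.im| ≤ η := by
  have hre : |w.re| ≤ η := by
    rcases h with ⟨h1, _⟩ | ⟨_, h2 | h2⟩
    · exact abs_le.2 ⟨h1.1, h1.2⟩
    · rw [h2, abs_neg, abs_of_pos hη]
    · rw [h2, abs_of_pos hη]
  have him : |w.im| ≤ η := by
    rcases h with ⟨_, h2 | h2⟩ | ⟨h1, _⟩
    · rw [h2, abs_neg, abs_of_pos hη]
    · rw [h2, abs_of_pos hη]
    · exact abs_le.2 ⟨h1.1, h1.2⟩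
  have hlo : η ≤ ‖w‖ := by
    rcases h with ⟨_, h2⟩ | ⟨_, h2⟩
    · have hi : |w.im| = η := by
        rcases h2 with h2 | h2
        · rw [h2, abs_neg, abs_of_pos hη]
        · rw [h2, abs_of_pos hη]
      exact hi ▸ Complex.abs_im_le_norm w
    · have hr : |w.re| = η := by
        rcases h2 with h2 | h2
        · rw [h2, abs_neg, abs_of_pos hη]
        · rw [h2, abs_of_pos hη]
      exact hr ▸ Complex.abs_re_le_norm w
  have hhi : ‖w‖ ≤ 2 * η := by
    have := Complex.norm_le_abs_re_add_abs_im w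
    linarith
  exact ⟨hlo, hhi, hre, him⟩

/-- **The diagonal residue term** `r(s₂) = ∮_{∂Q(0,η)} g_{s₂}`: under the hypotheses of
`norm_lemma3g_diag_le`,
`|r(s₂)| ≤ 8η · B (3/(2η))^d (Cℓ₂)^{a} (Cℓ₂)^b R^η 2^{u+1+a} / |s₂|^{(u+1+a)+(v+1+b)}`
(perimeter `8η`). With `η ≍ 1/log R` this is `≪ B (log R)^{d−1} ℓ₂^{a+b}/|s₂|^{u+v+a+b+2}`,
GPY's bound (8.24) for the integrand of `I₃`. [cite: GoldstonPintzYildirim2009, Section 8 eq. 8.24] -/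
theorem norm_diagRes_le
    (hWz : ∀ z : ℂ, z ≠ 0 → -(4 * cbar / Real.log (|z.im| + 3)) ≤ z.re →
      zetaOne z ≠ 0 ∧ ‖(zetaOne z)⁻¹‖ ≤ C * Real.log (|z.im| + 3) / ‖z‖ ∧
        ‖zetaOne z‖ ≤ 1 + C * ‖z‖ * Real.log (|z.im| + 3))
    (hc : 0 ≤ cbar) (hC : 0 ≤ C) {B κ ρW : ℝ} (hB0 : 0 ≤ B)
    (hGB : ∀ s₁ s₂ : ℂ, -κ ≤ s₁.re → s₁.re ≤ 2 → -κ ≤ s₂.re → s₂.re ≤ 2 → ‖G s₁ s₂‖ ≤ B)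
    (hρ : ∀ s : ℂ, ‖s‖ ≤ ρW → 1 / 2 ≤ ‖zetaOne s‖ ∧ ‖zetaOne s‖ ≤ 3 / 2)
    {R : ℝ} (hR : 1 ≤ R) (a b d u v : ℕ) {η : ℝ} {s₂ : ℂ} (hη : 0 < η) (hηρ : 2 * η ≤ ρW)
    (hs₂ : 4 * η ≤ s₂.re) (hκ : η + s₂.re ≤ κ) (hquarter : η + s₂.re < 1 / 4)
    (hzfr : η + s₂.re ≤ 4 * cbar / Real.log (|s₂.im| + η + 3)) :
    ‖diagRes G R a b d u v η s₂‖ ≤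
      8 * η * (B * (3 / (2 * η)) ^ d * (C * Real.log (|s₂.im| + η + 3)) ^ a *
        (C * Real.log (|s₂.im| + η + 3)) ^ b * R ^ η * 2 ^ (u + 1 + a) *
        ((‖s₂‖ ^ (u + 1 + a))⁻¹ * (‖s₂‖ ^ (v + 1 + b))⁻¹)) := by
  have hpt : ∀ w : ℂ,
      ((w.re ∈ Icc (-η) η ∧ (w.im = -η ∨ w.im = η)) ∨ (w.im ∈ Icc (-η) η ∧ (w.re = -η ∨ w.re = η))) →
      ‖lemma3g G R a b d u v s₂ w‖ ≤
        B * (3 / (2 * η)) ^ d * (C * Real.log (|s₂.im| + η + 3)) ^ a *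
          (C * Real.log (|s₂.im| + η + 3)) ^ b * R ^ η * 2 ^ (u + 1 + a) *
          ((‖s₂‖ ^ (u + 1 + a))⁻¹ * (‖s₂‖ ^ (v + 1 + b))⁻¹) := by
    intro w hw
    obtain ⟨h1, h2, h3, h4⟩ := square_boundary_norms hη hw
    exact norm_lemma3g_diag_le hWz hc hC hB0 hGB hρ hR a b d u v hη hηρ hs₂ hκ hquarter hzfr h1 h2 h3 h4
  have h := Literature.Analysis.Complex.norm_rectBoundaryIntegral_le (F := lemma3g G R a b d u v s₂)
    (a := -η) (b := η) (c := -η) (d := η) (by linarith) (by linarith)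
    (fun x hx => hpt _ (Or.inl ⟨by simpa using hx, Or.inl (by simp)⟩))
    (fun x hx => hpt _ (Or.inl ⟨by simpa using hx, Or.inr (by simp)⟩))
    (fun y hy => hpt _ (Or.inr ⟨by simpa using hy, Or.inl (by simp)⟩))
    (fun y hy => hpt _ (Or.inr ⟨by simpa using hy, Or.inr (by simp)⟩))
  rw [diagRes]
  refine h.trans (le_of_eq ?_)
  ring

end Inner

end Literature.NumberTheory.Sieve.GPY
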